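import Summits.NavierStokesRegularity.NavierStokesRegularity.Theses.AngularGalerkinLadder
import Summits.NavierStokesRegularity.NavierStokesRegularity.Theorems.NoOverheating.Negative.LadderLimitJoint
import Summits.NavierStokesRegularity.NavierStokesRegularity.Theorems.NoOverheating.Negative.TimePeriodicProfilesExcluded
import HarnessLib

/-!
# KJ-65 — Window sequences that are ASYMPTOTICALLY time-periodic are excluded
# (route `AngularGalerkinLadder`, crux K2 `NoOverheating`; refuter lineage, Negative lane)

Stratum (S25), SEQUENCE-level, the time companion of (S18)–(S20)/(S23) and the defect version of
(S24): if along an admissible window sequence the time-periodicity DEFECT with periods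
`τₙ → τ₀ > 0` tends to zero pointwise on the past, `uₙ(t − τₙ, x) − uₙ(t, x) → 0` (`t < 0`), then
by the JOINT space–time convergence of the ladder limit on compact cylinders
(`AngularGalerkinLadderLadderLimitJoint.exists_ladderLimit_joint`; the time argument `t − τₙ`
moves) the limit `v` is `τ₀`-periodic in time on the past; being `(c', R')`-RDSS and jointly
continuous it is steady (KJ-64 `steady_of_timePeriodic_of_isRotatedDSS`), hence zero by its
Type-I decay (KJ-58 `eq_zero_of_steady_of_hasTypeIDecay`) — against non-triviality.  Any `C₀`,
any rotations, any window.

* `tendsto_uncurry_of_tendstoUniformlyOn_cylinders` — evaluation of the joint convergence along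
  moving space–time points with limit in the open past (the reusable form of KJ-62b/KJ-63's
  cylinder argument);
* `no_windowSequence_asymptoticallyTimePeriodic` — (S25); `…_census` — census form.

READING FOR THE CIRCUIT: the supply's unsteadiness cannot even become asymptotically PERIODIC in
physical time along the ladder ((S20): it cannot vanish).  No `kit`.
[cite: KochNadirashviliSereginSverak2009, Lemma 6.1 (limits of rescaled solutions); §6] -/

namespace Summit.NavierStokesRegularity.AngularGalerkinLadderAsymptoticTimePeriodicityExcluded

open Set Filter MeasureTheory Topology Function
open Literature.Analysis Literature.Analysis.FluidPDE
open Summit.NavierStokesRegularity.FluidComputer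
open Summit.NavierStokesRegularity.FluidComputer.AngularLadder
open Summit.NavierStokesRegularity.NavierStokesRegularity.Theses.AngularGalerkinLadder
open Summit.NavierStokesRegularity.AngularGalerkinLadderLadderLimitJoint
open Summit.NavierStokesRegularity.AngularGalerkinLadderAsymptoticSymmetryExcluded
open Summit.NavierStokesRegularity.AngularGalerkinLadderTimePeriodicProfilesExcluded

/-! ## §1 Evaluating the joint convergence along moving space–time points -/

/-- **Joint convergence on the standard cylinders, evaluated along moving points.**  If
`uncurry uₙ → uncurry v` uniformly on every cylinder `[−(m+2), −1/(m+2)] × B̄(0, m+2)`, `v` is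
jointly continuous on `(−∞, 0) × ℝ³`, and `zₙ → z₀` with `z₀` in the open past, then
`uncurry uₙ (zₙ) → uncurry v (z₀)`. [cite: KochNadirashviliSereginSverak2009, Lemma 6.1 (limits of rescaled solutions)] -/
theorem tendsto_uncurry_of_tendstoUniformlyOn_cylinders
    {u : ℕ → ℝ → EuclideanSpace ℝ (Fin 3) → EuclideanSpace ℝ (Fin 3)}
    {v : ℝ → EuclideanSpace ℝ (Fin 3) → EuclideanSpace ℝ (Fin 3)}
    (hunif : ∀ m : ℕ, TendstoUniformlyOn (fun j => uncurry (u j)) (uncurry v) atTop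
      (Icc (-((m : ℝ) + 2)) (-(1 / ((m : ℝ) + 2))) ×ˢ
        Metric.closedBall (0 : EuclideanSpace ℝ (Fin 3)) ((m : ℝ) + 2)))
    (hvcont : ContinuousOn (uncurry v) (Iio 0 ×ˢ univ))
    {z : ℕ → ℝ × EuclideanSpace ℝ (Fin 3)} {z₀ : ℝ × EuclideanSpace ℝ (Fin 3)} (hz₀ : z₀.1 < 0)
    (hz : Tendsto z atTop (𝓝 z₀)) :
    Tendsto (fun n => uncurry (u n) (z n)) atTop (𝓝 (uncurry v z₀)) := by
  -- a standard cylinder containing `z₀` in its interior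
  set a : ℝ := -z₀.1 with ha_def
  have ha : 0 < a := by rw [ha_def]; linarith
  have hainv : 0 < a⁻¹ := inv_pos.2 ha
  obtain ⟨m, hm⟩ := exists_nat_gt (a + a⁻¹ + ‖z₀.2‖)
  set S : Set (ℝ × EuclideanSpace ℝ (Fin 3)) :=
    Icc (-((m : ℝ) + 2)) (-(1 / ((m : ℝ) + 2))) ×ˢ
      Metric.closedBall (0 : EuclideanSpace ℝ (Fin 3)) ((m : ℝ) + 2) with hS
  have h_lo : -((m : ℝ) + 2) < z₀.1 := by
    have : a < (m : ℝ) + 2 := by linarith [norm_nonneg z₀.2]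
    rw [ha_def] at this; linarith
  have h_hi : z₀.1 < -(1 / ((m : ℝ) + 2)) := by
    have h1 : a⁻¹ < (m : ℝ) + 2 := by linarith [norm_nonneg z₀.2]
    have h2 : 1 / ((m : ℝ) + 2) < a := by
      rw [one_div]
      calc ((m : ℝ) + 2)⁻¹ < a⁻¹⁻¹ := inv_strictAnti₀ hainv h1
        _ = a := inv_inv a
    rw [ha_def] at h2; linarith
  have h_ball : z₀.2 ∈ Metric.ball (0 : EuclideanSpace ℝ (Fin 3)) ((m : ℝ) + 2) := by
    rw [Metric.mem_ball, dist_zero_right]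
    linarith [ha.le, hainv.le]
  have hSz : S ∈ 𝓝 z₀ := by
    rw [← Prod.mk.eta (p := z₀)]
    refine mem_of_superset (prod_mem_nhds (isOpen_Ioo.mem_nhds ⟨h_lo, h_hi⟩)
      (Metric.isOpen_ball.mem_nhds h_ball)) ?_
    exact prod_mono Ioo_subset_Icc_self Metric.ball_subset_closedBall
  have hSsub : S ⊆ Iio 0 ×ˢ univ := by
    refine prod_mono (fun s hs => ?_) (subset_univ _)
    have hm0 : (0 : ℝ) < 1 / ((m : ℝ) + 2) := by positivity
    exact lt_of_le_of_lt hs.2 (by linarith)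
  have hzS : Tendsto z atTop (𝓝[S] z₀) := tendsto_nhdsWithin_iff.2 ⟨hz, hz.eventually_mem hSz⟩
  have hcont : ContinuousWithinAt (uncurry v) S z₀ := by
    have h := hvcont z₀ (by
      rw [← Prod.mk.eta (p := z₀)]
      exact mk_mem_prod (mem_Iio.2 hz₀) (mem_univ _))
    exact h.mono hSsub
  exact (hunif m).tendsto_comp hcont hzS

/-! ## §2 (S25): no admissible window sequence is asymptotically time-periodic -/

variable {C₀ cmin cmax δ : ℝ} {L : ℕ → ℕ} {ε c : ℕ → ℝ}
  {R : ℕ → (EuclideanSpace ℝ (Fin 3) ≃ₗᵢ[ℝ] EuclideanSpace ℝ (Fin 3))}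
  {u : ℕ → ℝ → EuclideanSpace ℝ (Fin 3) → EuclideanSpace ℝ (Fin 3)}
  {p : ℕ → ℝ → EuclideanSpace ℝ (Fin 3) → ℝ}
  {d : ℕ → ℝ → EuclideanSpace ℝ (Fin 3) → EuclideanSpace ℝ (Fin 3)}

/-- **(S25) No admissible window sequence has a vanishing time-periodicity defect with periods
tending to a positive limit.**  `1 < cmin`, `0 < δ`, `εₙ → 0`, window rung profiles with constant
`C₀` — ANY `C₀`, ANY rotations, ANY window — and periods `τₙ → τ₀ > 0` with
`uₙ(t − τₙ, x) − uₙ(t, x) → 0` pointwise on the past are contradictory: the ladder limit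
(`exists_ladderLimit_joint`) is `τ₀`-periodic in time
(`tendsto_uncurry_of_tendstoUniformlyOn_cylinders` at the moving points `(t − τₙ, x)`), RDSS and
jointly continuous, hence steady (`steady_of_timePeriodic_of_isRotatedDSS`) and zero by Type-I
decay (`eq_zero_of_steady_of_hasTypeIDecay`) — against non-triviality.
[cite: KochNadirashviliSereginSverak2009, Lemma 6.1 (limits of rescaled solutions); §6] -/
theorem no_windowSequence_asymptoticallyTimePeriodic (hcmin : 1 < cmin) (hδ : 0 < δ)
    (hε : Tendsto ε atTop (𝓝 0))
    (hW : ∀ n, IsWindowProfile (L n) C₀ cmin cmax δ (ε n) (c n) (R n) (u n) (p n) (d n))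
    (τ : ℕ → ℝ) {τ₀ : ℝ} (hτ₀ : 0 < τ₀) (hτ : Tendsto τ atTop (𝓝 τ₀))
    (hdef : ∀ t < 0, ∀ x, Tendsto (fun n => u n (t - τ n) x - u n t x) atTop (𝓝 0)) :
    False := by
  obtain ⟨φ, c', R', v, hφ, -, -, -, hptw, -, hvcont, hc', -, -, hdss, hTI, -, hnz, hunif⟩ :=
    exists_ladderLimit_joint hcmin hδ hε hW
  -- the limit is `τ₀`-periodic in time on the past
  have hper : ∀ t < 0, ∀ x, v (t - τ₀) x = v t x := by
    intro t ht x
    have htτ : t - τ₀ < 0 := by linarith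
    have hz : Tendsto (fun n => (t - τ (φ n), x)) atTop
        (𝓝 ((t - τ₀, x) : ℝ × EuclideanSpace ℝ (Fin 3))) :=
      (tendsto_const_nhds.sub (hτ.comp hφ.tendsto_atTop)).prodMk_nhds tendsto_const_nhds
    have hL : Tendsto (fun n => u (φ n) (t - τ (φ n)) x) atTop (𝓝 (v (t - τ₀) x)) :=
      tendsto_uncurry_of_tendstoUniformlyOn_cylinders hunif hvcont (z₀ := (t - τ₀, x)) htτ hz
    have h0 : v (t - τ₀) x - v t x = 0 :=
      tendsto_nhds_unique (hL.sub (hptw t ht x)) ((hdef t ht x).comp hφ.tendsto_atTop)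
    exact sub_eq_zero.1 h0
  -- periodic + RDSS + continuous in time ⇒ steady ⇒ zero
  have hcont : ∀ x, ContinuousOn (fun s => v s x) (Iio 0) := fun x s hs => by
    have h1 : ContinuousWithinAt (uncurry v) (Iio 0 ×ˢ univ) (s, x) :=
      hvcont (s, x) (mk_mem_prod hs (mem_univ _))
    have h2 : ContinuousWithinAt (fun r : ℝ => (r, x)) (Iio 0) s :=
      (continuous_id.prodMk continuous_const).continuousWithinAt
    have h3 : MapsTo (fun r : ℝ => (r, x)) (Iio 0) (Iio (0 : ℝ) ×ˢ (univ : Set _)) :=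
      fun r hr => mk_mem_prod hr (mem_univ _)
    have h4 := ContinuousWithinAt.comp (f := fun r : ℝ => (r, x)) (x := s) h1 h2 h3
    exact h4
  have hst := steady_of_timePeriodic_of_isRotatedDSS hc' hdss hcont hτ₀ hper
  have hz := eq_zero_of_steady_of_hasTypeIDecay hTI hst
  exact hnz fun t ht => Eventually.of_forall fun x => by simpa using hz t ht x

/-- **(S25) in census form**: the time-periodicity defect of an admissible window sequence, with
periods tending to a positive limit, cannot tend to zero. -/
theorem no_windowSequence_asymptoticallyTimePeriodic_census (hcmin : 1 < cmin) (hδ : 0 < δ)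
    (hε : Tendsto ε atTop (𝓝 0))
    (hW : ∀ n, IsWindowProfile (L n) C₀ cmin cmax δ (ε n) (c n) (R n) (u n) (p n) (d n)) :
    ¬ (∃ (τ : ℕ → ℝ) (τ₀ : ℝ), 0 < τ₀ ∧ Tendsto τ atTop (𝓝 τ₀) ∧
        ∀ t < 0, ∀ x, Tendsto (fun n => u n (t - τ n) x - u n t x) atTop (𝓝 0)) :=
  fun ⟨τ, _, hτ₀, hτ, hdef⟩ =>
    no_windowSequence_asymptoticallyTimePeriodic hcmin hδ hε hW τ hτ₀ hτ hdef

end Summit.NavierStokesRegularity.AngularGalerkinLadderAsymptoticTimePeriodicityExcluded
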